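import Summits.Ventures.PercRepro.Night2T3Planes4Large

/-!
# PercRepro — the type-`3` balance when every circuit has `≥ 5` elements (night-2, NIGHT-2-t3.md §7, Theorem G)

Under `hgirth : ∀ C ⊆ G, M.IsCircuit C → 5 ≤ C.encard` every spanning non-basis `S ⊆ G` contains a circuit `C` of
`≥ 5` elements, which lies in the cyclic part of `S` (a coloop of `S` is in no circuit of `S`), so the cyclic part has
rank `≥ 4`: `m(S) + 4 ≤ q` (`mTr_add_four_le_of_girth`).  The lower degree bound becomes `(d − j + 4)·#C_j ≤
(j + 1)·#C_{j+1}` for every `j < d` (`succ_mul_card_ge_of_girth`), so the profile `T_k = C(d+4, k)` applies on the whole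
range and the Chebyshev comparison gives `Σ_A (d + 3 − 2|A|) ≤ 0` as soon as
`σ_d = −2^{d+4} + C(d+4,3)(d−1) + C(d+4,2)(d+1) + (d+4)(d+3) + (d+5) ≤ 0`, i.e. for every `d ≥ 6` (`sigma_girth_nonpos`;
`σ_6 = −8`, the uniform matroid `U_{4,10}`).  With Theorem C for `d ≤ 5`: **`0 ≤ J_3(G)` for every rank-`q` set `G` of a
simple matroid with `4 ≤ q` all of whose circuits have `≥ 5` elements** — Theorem G in the kernel.
Imports `Night2T3Planes4Large` only.
-/
namespace PercRepro.Star

open Finset ThmH SixFour GenQ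

/-! ## The profile sum -/

/-- The crude polynomial majorant of the tail of `σ`. -/
noncomputable def tailMajorantG (d : ℚ) : ℚ :=
  ((d + 4) ^ 3 / 6) * (d - 1) + ((d + 4) ^ 2 / 2) * (d + 1) + (d + 4) * (d + 3) + (d + 5)

/-- `R(7 + m) ≤ 2^(11 + m)` for every `m`. -/
theorem tailMajorantG_le_two_pow (m : ℕ) : tailMajorantG ((7 : ℚ) + m) ≤ (2 : ℚ) ^ (11 + m) := by
  induction m with
  | zero =>
    unfold tailMajorantG
    norm_num
  | succ m ih =>
    have hstep : tailMajorantG ((7 : ℚ) + (m + 1 : ℕ)) ≤ 2 * tailMajorantG ((7 : ℚ) + m) := by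
      have hm : (0 : ℚ) ≤ (m : ℚ) := by positivity
      have key : 2 * tailMajorantG ((7 : ℚ) + m) - tailMajorantG ((7 : ℚ) + (m + 1 : ℕ)) =
          1065 + 1544 / 3 * (m : ℚ) + 175 / 2 * (m : ℚ) ^ 2 + 19 / 3 * (m : ℚ) ^ 3 + 1 / 6 * (m : ℚ) ^ 4 := by
        unfold tailMajorantG
        push_cast
        ring
      have : (0 : ℚ) ≤ 1065 + 1544 / 3 * (m : ℚ) + 175 / 2 * (m : ℚ) ^ 2 + 19 / 3 * (m : ℚ) ^ 3 +
          1 / 6 * (m : ℚ) ^ 4 := by positivity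
      linarith
    calc tailMajorantG ((7 : ℚ) + (m + 1 : ℕ)) ≤ 2 * tailMajorantG ((7 : ℚ) + m) := hstep
      _ ≤ 2 * (2 : ℚ) ^ (11 + m) := by linarith
      _ = (2 : ℚ) ^ (11 + (m + 1)) := by ring

/-- **`σ_d ≤ 0` for `d ≥ 6`.** -/
theorem sigma_girth_nonpos (d : ℕ) (hd : 6 ≤ d) :
    -(2 : ℚ) ^ (d + 4) + ((d + 4).choose 3 : ℚ) * ((d : ℚ) - 1) + ((d + 4).choose 2 : ℚ) * ((d : ℚ) + 1) +
        ((d : ℚ) + 4) * ((d : ℚ) + 3) + ((d : ℚ) + 5) ≤ 0 := by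
  rcases Nat.lt_or_ge d 7 with h6 | h7
  · have : d = 6 := by omega
    subst this
    norm_num [Nat.choose]
  · obtain ⟨m, rfl⟩ : ∃ m, d = 7 + m := ⟨d - 7, by omega⟩
    have c3 : ((7 + m + 4).choose 3 : ℚ) ≤ ((7 + m + 4 : ℕ) : ℚ) ^ 3 / (3 : ℕ).factorial :=
      Nat.choose_le_pow_div 3 (7 + m + 4)
    have c2 : ((7 + m + 4).choose 2 : ℚ) ≤ ((7 + m + 4 : ℕ) : ℚ) ^ 2 / (2 : ℕ).factorial :=
      Nat.choose_le_pow_div 2 (7 + m + 4)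
    have hmaj := tailMajorantG_le_two_pow m
    have hd1 : (0 : ℚ) ≤ ((7 + m : ℕ) : ℚ) - 1 := by push_cast; linarith [(by positivity : (0:ℚ) ≤ (m:ℚ))]
    have hdp : (0 : ℚ) ≤ ((7 + m : ℕ) : ℚ) + 1 := by positivity
    have e3 := mul_le_mul_of_nonneg_right c3 hd1
    have e2 := mul_le_mul_of_nonneg_right c2 hdp
    have hpow : (2 : ℚ) ^ (7 + m + 4) = (2 : ℚ) ^ (11 + m) := by
      rw [show 7 + m + 4 = 11 + m by omega]
    unfold tailMajorantG at hmaj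
    simp only [Nat.factorial] at e3 e2
    push_cast at e3 e2 hmaj ⊢
    rw [hpow]
    nlinarith [e3, e2, hmaj]

variable {α : Type*} [DecidableEq α] {M : Matroid α} [M.Finite]

/-! ## The structural lemma -/

/-- If every circuit of `M` inside `G` has `≥ 5` elements, a rank-`q` subset `S ⊆ G` with more than `q` points has a
cyclic part of rank `≥ 4`, i.e. at most `q − 4` coloops. -/
theorem mTr_add_four_le_of_girth {G : Finset α} {q : ℕ} (hG : G ⊆ gr M)
    (hgirth : ∀ C : Set α, C ⊆ (G : Set α) → M.IsCircuit C → 5 ≤ C.encard) {S : Finset α} (hS : S ⊆ G)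
    (hr : M.eRk (S : Set α) = (q : ℕ∞)) (hlt : q < S.card) : mTr M S + 4 ≤ q := by
  set Cl := coloopsOf M S with hCl
  have hsum := eRk_sdiff_add_card_eq_of_subset_coloopsOf (hS.trans hG) Cl (Finset.Subset.refl _)
  rw [hr] at hsum
  obtain ⟨r, hr'⟩ := exists_eRk_eq_nat (M := M) (S \ Cl)
  rw [hr'] at hsum
  have hrm : r + Cl.card = q := by exact_mod_cast hsum
  have hm : mTr M S = Cl.card := rfl
  have hSE : (S : Set α) ⊆ M.E := by
    rw [← coe_gr M]
    exact_mod_cast hS.trans hG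
  -- `S` is dependent
  have hdep : M.Dep (S : Set α) := by
    rw [Matroid.dep_iff]
    refine ⟨fun hI => ?_, hSE⟩
    rw [Matroid.indep_iff_eRk_eq_encard_of_finite (Finset.finite_toSet S), hr,
      Set.encard_coe_eq_coe_finsetCard] at hI
    have : q = S.card := by exact_mod_cast hI
    omega
  obtain ⟨C, hCS, hC⟩ := hdep.exists_isCircuit_subset
  -- the circuit avoids the coloops of `S`
  have hCZ : C ⊆ ((S \ Cl : Finset α) : Set α) := by
    intro e he
    rw [Finset.coe_sdiff]
    refine ⟨hCS he, fun heCl => ?_⟩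
    have heCl' := (mem_coloopsOf.1 (Finset.mem_coe.1 heCl)).2
    apply heCl'
    have h1 := hC.mem_closure_sdiff_singleton_of_mem he
    refine M.closure_subset_closure ?_ h1
    intro y hy
    rw [Finset.coe_erase]
    exact ⟨hCS hy.1, hy.2⟩
  have h5 := hgirth C (hCS.trans (Finset.coe_subset.2 hS)) hC
  have hC1 := hC.eRk_add_one_eq
  have hfin : C.Finite := (Finset.finite_toSet S).subset hCS
  rw [← hfin.cast_ncard_eq] at hC1 h5
  have hne : M.eRk C ≠ ⊤ := by
    intro htop
    rw [htop, top_add] at hC1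
    exact ENat.coe_ne_top _ hC1.symm
  obtain ⟨rc, hrc⟩ : ∃ rc : ℕ, M.eRk C = (rc : ℕ∞) := ⟨(M.eRk C).toNat, (ENat.coe_toNat hne).symm⟩
  rw [hrc] at hC1
  have hrc1 : rc + 1 = C.ncard := by exact_mod_cast hC1
  have h5' : 5 ≤ C.ncard := by exact_mod_cast h5
  have hCle : M.eRk C ≤ M.eRk ((S \ Cl : Finset α) : Set α) := M.eRk_mono hCZ
  rw [hrc, hr'] at hCle
  have hrcr : rc ≤ r := by exact_mod_cast hCle
  omega

/-- **The lower degree bound under the girth condition**: `(d − j + 4)·#C_j ≤ (j + 1)·#C_{j+1}` for `j + 1 ≤ d`. -/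
theorem succ_mul_card_ge_of_girth {G : Finset α} {q : ℕ} (hG : G ⊆ gr M)
    (hrG : M.eRk (G : Set α) = (q : ℕ∞))
    (hgirth : ∀ C : Set α, C ⊆ (G : Set α) → M.IsCircuit C → 5 ≤ C.encard) {j : ℕ}
    (hj : j + 1 ≤ G.card - q) :
    (G.card - q - j + 4) * ((Rq M G q).filter (fun S : Finset α => (G \ S).card = j)).card ≤
      (j + 1) * ((Rq M G q).filter (fun S : Finset α => (G \ S).card = j + 1)).card := by
  rw [← sum_card_sub_mTr_eq_succ_mul_card hG hrG j, mul_comm, Finset.card_eq_sum_ones, Finset.sum_mul]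
  apply Finset.sum_le_sum
  intro S hS
  rw [Finset.mem_filter] at hS
  have hS' := mem_Rq.1 hS.1
  have hsd := Finset.card_sdiff_of_subset hS'.1
  have hle := Finset.card_le_card hS'.1
  have hSq : q ≤ S.card := le_card_of_eRk_eq hS'.2
  have hlt : q < S.card := by omega
  have hm := mTr_add_four_le_of_girth hG hgirth hS'.1 hS'.2 hlt
  rw [one_mul]
  omega

/-- **Corank `≥ 6` under the girth condition**: `0 ≤ J_3(G)` for `4 ≤ q`, `q + 6 ≤ |G|`, every circuit in `G` with
`≥ 5` elements. -/
theorem Jq_three_nonneg_of_girth_of_add_six_le (hs : Simple M) {G : Finset α} {q : ℕ} (hG : G ⊆ gr M)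
    (hrG : M.eRk (G : Set α) = (q : ℕ∞)) (hq : 4 ≤ q)
    (hgirth : ∀ C : Set α, C ⊆ (G : Set α) → M.IsCircuit C → 5 ≤ C.encard) (hcard : q + 6 ≤ G.card) :
    0 ≤ Jq M G q 3 := by
  obtain ⟨d, hd⟩ : ∃ d, G.card = q + d := ⟨G.card - q, by omega⟩
  have hd6 : 6 ≤ d := by omega
  obtain ⟨e, rfl⟩ : ∃ e, d = e + 1 := ⟨d - 1, by omega⟩
  apply Jq_three_nonneg_of_split hs hG hrG (by omega) hd
  set i : ℕ → ℚ := fun j => ((((Rq M G q).filter (fun S : Finset α => (G \ S).card = j)).card : ℕ) : ℚ) with hi_def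
  set n := e + 5 with hn
  set T : ℕ → ℚ := fun k => (n.choose k : ℚ) with hT_def
  set g : ℕ → ℚ := fun k => ((e + 1 : ℕ) : ℚ) + 3 - 2 * (k : ℚ) with hg_def
  have hsum : ∑ j ∈ Finset.range (e + 1 + 1), i j * (2 * (j : ℚ) - ((e + 1 : ℕ) : ℚ) - 3) =
      -∑ j ∈ Finset.range (e + 1 + 1), i j * g j := by
    rw [← Finset.sum_neg_distrib]
    apply Finset.sum_congr rfl
    intro j _
    simp only [hg_def]
    ring
  have hTpos : ∀ k ∈ Finset.range (e + 1 + 1), 0 < T k := by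
    intro k hk
    have hk' := Finset.mem_range.1 hk
    simp only [hT_def]
    exact_mod_cast Nat.choose_pos (by omega)
  have hratio : ∀ k, k < e + 1 → i k * T (k + 1) ≤ i (k + 1) * T k := by
    intro k hk
    simp only [hT_def]
    have hch := Nat.choose_succ_right_eq n k
    have hch' : (n.choose (k + 1) : ℚ) * ((k : ℚ) + 1) = (n.choose k : ℚ) * ((n - k : ℕ) : ℚ) := by
      exact_mod_cast hch
    have hL := succ_mul_card_ge_of_girth hG hrG hgirth (j := k) (by omega)
    rw [hd, show q + (e + 1) - q - k + 4 = n - k by omega] at hL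
    have hL' : ((n - k : ℕ) : ℚ) * i k ≤ ((k : ℚ) + 1) * i (k + 1) := by
      simp only [hi_def]
      exact_mod_cast hL
    have hk1 : (0 : ℚ) < (k : ℚ) + 1 := by positivity
    have hc0 : (0 : ℚ) ≤ (n.choose k : ℚ) := by positivity
    have : i k * (n.choose (k + 1) : ℚ) * ((k : ℚ) + 1) ≤ i (k + 1) * (n.choose k : ℚ) * ((k : ℚ) + 1) := by
      calc i k * (n.choose (k + 1) : ℚ) * ((k : ℚ) + 1) = i k * ((n.choose k : ℚ) * ((n - k : ℕ) : ℚ)) := by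
            rw [mul_assoc, hch']
        _ = (n.choose k : ℚ) * (((n - k : ℕ) : ℚ) * i k) := by ring
        _ ≤ (n.choose k : ℚ) * (((k : ℚ) + 1) * i (k + 1)) := mul_le_mul_of_nonneg_left hL' hc0
        _ = i (k + 1) * (n.choose k : ℚ) * ((k : ℚ) + 1) := by ring
    exact le_of_mul_le_mul_right this hk1
  have hg : ∀ j ∈ Finset.range (e + 1 + 1), ∀ k ∈ Finset.range (e + 1 + 1), j ≤ k → g k ≤ g j := by
    intro j _ k _ hjk
    simp only [hg_def]
    have : (j : ℚ) ≤ (k : ℚ) := by exact_mod_cast hjk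
    linarith
  have hcheb := ratio_profile_bound (e + 1) i T g hTpos hratio hg
  -- the profile sum is `σ_{e+1}`
  have hprof : ∑ k ∈ Finset.range (e + 1 + 1), T k * g k =
      -(2 : ℚ) ^ (e + 1 + 4) + ((e + 1 + 4).choose 3 : ℚ) * (((e + 1 : ℕ) : ℚ) - 1) +
        ((e + 1 + 4).choose 2 : ℚ) * (((e + 1 : ℕ) : ℚ) + 1) +
        (((e + 1 : ℕ) : ℚ) + 4) * (((e + 1 : ℕ) : ℚ) + 3) + (((e + 1 : ℕ) : ℚ) + 5) := by
    have hfull := sum_range_choose_mul_sub n (((e + 1 : ℕ) : ℚ) + 3)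
    have hfull' : ∑ k ∈ Finset.range (n + 1), (n.choose k : ℚ) * g k = -(2 : ℚ) ^ n := by
      rw [show (-(2 : ℚ) ^ n) = ((((e + 1 : ℕ) : ℚ) + 3) - (n : ℚ)) * 2 ^ n by
        rw [hn]; push_cast; ring]
      rw [← hfull]
    have hn1 : n + 1 = e + 1 + 1 + 4 := by omega
    rw [hn1, Finset.sum_range_succ, Finset.sum_range_succ, Finset.sum_range_succ,
      Finset.sum_range_succ] at hfull'
    have b0 : n.choose (e + 1 + 1 + 3) = 1 := by
      rw [hn, show e + 1 + 1 + 3 = e + 5 by omega]; exact Nat.choose_self _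
    have b1 : n.choose (e + 1 + 1 + 2) = e + 5 := by
      rw [hn, show e + 1 + 1 + 2 = e + 4 by omega]
      exact Nat.choose_succ_self_right (e + 4)
    have b2 : n.choose (e + 1 + 1 + 1) = (e + 1 + 4).choose 2 := by
      rw [hn, show e + 5 = (e + 3) + 2 by omega, show e + 1 + 1 + 1 = e + 3 by omega,
        show e + 1 + 4 = e + 3 + 2 by omega]
      exact Nat.choose_symm_add
    have b3 : n.choose (e + 1 + 1) = (e + 1 + 4).choose 3 := by
      rw [hn, show e + 5 = (e + 2) + 3 by omega, show e + 1 + 1 = e + 2 by omega,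
        show e + 1 + 4 = e + 2 + 3 by omega]
      exact Nat.choose_symm_add
    rw [b0, b1, b2, b3] at hfull'
    simp only [hT_def, hg_def] at hfull' ⊢
    push_cast at hfull' ⊢
    rw [hn] at hfull' ⊢
    linarith [hfull']
  have hsig := sigma_girth_nonpos (e + 1) (by omega)
  have hprof' : ∑ k ∈ Finset.range (e + 1 + 1), T k * g k ≤ 0 := by
    rw [hprof]
    exact hsig
  have hTsum : 0 < ∑ k ∈ Finset.range (e + 1 + 1), T k :=
    Finset.sum_pos hTpos ⟨0, Finset.mem_range.2 (by omega)⟩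
  have hisum : 0 ≤ ∑ k ∈ Finset.range (e + 1 + 1), i k :=
    Finset.sum_nonneg (fun k _ => by simp only [hi_def]; positivity)
  have hneg : ∑ k ∈ Finset.range (e + 1 + 1), i k * g k ≤ 0 := by
    have h1 : (∑ k ∈ Finset.range (e + 1 + 1), i k) * (∑ k ∈ Finset.range (e + 1 + 1), T k * g k) ≤ 0 :=
      mul_nonpos_of_nonneg_of_nonpos hisum hprof'
    have h2 := hcheb.trans h1
    by_contra hpos
    push Not at hpos
    have := mul_pos hpos hTsum
    linarith
  have hDF : (0 : ℚ) ≤ ((q : ℚ) + 2) *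
      ((((Rq M G q).filter (fun S : Finset α => (G \ S).card ≤ 2)).card : ℕ) : ℚ) := by positivity
  rw [hsum]
  linarith

/-- **THEOREM G in the kernel**: on a simple matroid, `0 ≤ J_3(G)` for every rank-`q` set `G` with `4 ≤ q` all of
whose circuits have `≥ 5` elements — every corank. -/
theorem Jq_three_nonneg_of_girth (hs : Simple M) {G : Finset α} {q : ℕ} (hG : G ⊆ gr M)
    (hrG : M.eRk (G : Set α) = (q : ℕ∞)) (hq : 4 ≤ q)
    (hgirth : ∀ C : Set α, C ⊆ (G : Set α) → M.IsCircuit C → 5 ≤ C.encard) : 0 ≤ Jq M G q 3 := by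
  have hqG : q ≤ G.card := le_card_of_eRk_eq hrG
  rcases Nat.lt_or_ge G.card (q + 4) with h3 | h4
  · exact Jq_three_nonneg_of_card_le_add_three hs hG hrG hq (by omega)
  rcases Nat.lt_or_ge G.card (q + 5) with h4' | h5
  · exact Jq_three_nonneg_of_card_eq_add_four hs hG hrG hq (by omega)
  rcases Nat.lt_or_ge G.card (q + 6) with h5' | h6
  · exact Jq_three_nonneg_of_card_eq_add_five hs hG hrG hq (by omega)
  · exact Jq_three_nonneg_of_girth_of_add_six_le hs hG hrG hq hgirth h6

end PercRepro.Star
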